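import Summits.QuantumFields.YangMills.Theorems.OneCertifiedCubeFiniteSizeCriterionTorus
import HarnessLib

/-!
# `FixedTorusFirst` — torus-comparison tools for the crux `FiniteSizeInsensitivity`

Route `route-QuantumFields-FixedTorusFirst` (a sub-line under `BalabanLadder.NT`, ladder rung R2a),
crux `Summit.QuantumFields.YangMills.Theses.FixedTorusFirst.FiniteSizeInsensitivity`
(item `stmt-QuantumFields-27355`).  Helper file (no item is closed here) for the strong-coupling
BC5 rung `Theorems/FixedTorusFirstStrongCouplingFiniteSizeRung.lean`:

* `abs_torusMean_sub_torusMean_le` — **one-point comparison across two tori**: if a box `Λ`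
  together with the support of a bounded measurable cylinder observable `F` and the collar of `Λ`
  injects into both tori `(ℤ/M₁)⁴`, `(ℤ/M₂)⁴`, the two torus Wilson means of `F` differ by at most
  the oscillation of the box-kernel mean `η ↦ γ_Λ(F | η)` over exterior conditions (torus DLR
  equation with far factor `H = 1`,
  `integral_torusLift_mul_eq_integral_ymSpecification_mul_of_measurable`, on each torus, then
  averaging);
* `abs_latticeConnectedCorr_le_two_mul` — the trivial bound `|⟨A; τ_t B⟩| ≤ 2‖A‖‖B‖`;
* `abs_integral_sub_integral_le_of_forall`, `pow_four_le_mul_exp` — bookkeeping.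

Lattice units; nothing about the continuum limit, the mass gap, `NT` or the summit is proved here.
References: Georgii, *Gibbs Measures and Phase Transitions* (2011) §8.2 (DLR on the torus);
Dobrushin–Shlosman (1985) §2.
-/

set_option autoImplicit false

noncomputable section

open MeasureTheory Filter
open Literature.Probability.LatticeModels
open Literature.MathematicalPhysics.QuantumLattice
open Literature.MathematicalPhysics.QuantumFieldTheory (wilsonMeasure
  isProbabilityMeasure_wilsonMeasure latticeConnectedCorr measurable_torusLift
  isSpecification_ymSpecification_of_t2Space)
open Summit.QuantumFields.YangMills.Theorems.FiniteSizeCriterion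

namespace Summit.QuantumFields.YangMills.Cruxes.FiniteSizeInsensitivity.Rung

/-! ## Two elementary lemmas -/

/-- Means of two bounded measurable functions on two probability spaces whose values differ
pairwise by at most `Δ` differ by at most `Δ`. -/
theorem abs_integral_sub_integral_le_of_forall {X Y : Type*} [MeasurableSpace X]
    [MeasurableSpace Y] (μ : Measure X) (ν : Measure Y) [IsProbabilityMeasure μ]
    [IsProbabilityMeasure ν] {g₁ : X → ℝ} {g₂ : Y → ℝ} (h₁m : Measurable g₁)
    (h₂m : Measurable g₂) {C : ℝ} (h₁b : ∀ x, |g₁ x| ≤ C) (h₂b : ∀ y, |g₂ y| ≤ C) {Δ : ℝ}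
    (hΔ : ∀ x y, |g₁ x - g₂ y| ≤ Δ) :
    |(∫ x, g₁ x ∂μ) - ∫ y, g₂ y ∂ν| ≤ Δ := by
  have h₁i : Integrable g₁ μ := integrable_of_abs_le h₁m h₁b
  have h₂i : Integrable g₂ ν := integrable_of_abs_le h₂m h₂b
  have step : ∀ x, |g₁ x - ∫ y, g₂ y ∂ν| ≤ Δ := fun x => by
    have e : g₁ x - ∫ y, g₂ y ∂ν = ∫ y, (g₁ x - g₂ y) ∂ν := by
      rw [integral_sub (integrable_const _) h₂i, integral_const]
      simp
    rw [e]
    exact abs_integral_le_of_abs_le fun y => hΔ x y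
  have e : (∫ x, g₁ x ∂μ) - ∫ y, g₂ y ∂ν = ∫ x, (g₁ x - ∫ y, g₂ y ∂ν) ∂μ := by
    rw [integral_sub h₁i (integrable_const _), integral_const]
    simp
  rw [e]
  exact abs_integral_le_of_abs_le fun x => step x

/-- Polynomial versus exponential: `x⁴ ≤ (4/δ)⁴ e^{δ x}` for `x ≥ 0`, `δ > 0`. -/
theorem pow_four_le_mul_exp {δ : ℝ} (hδ : 0 < δ) {x : ℝ} (hx : 0 ≤ x) :
    x ^ 4 ≤ (4 / δ) ^ 4 * Real.exp (δ * x) := by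
  have h1 : δ * x / 4 ≤ Real.exp (δ * x / 4) := by
    have := Real.add_one_le_exp (δ * x / 4)
    linarith
  have h2 : x ≤ 4 / δ * Real.exp (δ * x / 4) := by
    rw [div_mul_eq_mul_div, le_div_iff₀ hδ]
    linarith
  calc x ^ 4 ≤ (4 / δ * Real.exp (δ * x / 4)) ^ 4 := pow_le_pow_left₀ hx h2 4
    _ = (4 / δ) ^ 4 * Real.exp (δ * x) := by
        rw [mul_pow, ← Real.exp_nat_mul]
        congr 2
        push_cast
        ring

/-! ## Torus tools -/

section Torus

variable {N : ℕ} {G : Type} [Group G] [TopologicalSpace G] [IsTopologicalGroup G]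
  [CompactSpace G] [T2Space G] [SecondCountableTopology G] [MeasurableSpace G] [BorelSpace G]

omit [T2Space G] [SecondCountableTopology G] in
/-- The trivial bound `|⟨A; τ_t B⟩_M| ≤ 2‖A‖‖B‖` on any torus. -/
theorem abs_latticeConnectedCorr_le_two_mul (ρ : G →* Matrix (Fin N) (Fin N) ℂ)
    (hρ : Continuous ρ) (β : ℝ) (M : ℕ) [NeZero M] {A B : LGConfig 4 G → ℝ} {CA CB : ℝ}
    (hCA : ∀ U, |A U| ≤ CA) (hCB : ∀ U, |B U| ≤ CB) (t : ℕ) :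
    |latticeConnectedCorr ρ β M A B t| ≤ 2 * CA * CB := by
  haveI := isProbabilityMeasure_wilsonMeasure (d := 4) (L := M) ρ hρ β
  have hCA0 : 0 ≤ CA := (abs_nonneg _).trans (hCA fun _ => 1)
  unfold Literature.MathematicalPhysics.QuantumFieldTheory.latticeConnectedCorr
  have h1 : |∫ U, A (torusLift M U) *
      B (Literature.MathematicalPhysics.QuantumLattice.configShift (-Pi.single 0 (t : ℤ))
        (torusLift M U)) ∂(wilsonMeasure (d := 4) (L := M) ρ β)| ≤ CA * CB :=
    abs_integral_le_of_abs_le fun U => by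
      rw [abs_mul]
      exact mul_le_mul (hCA _) (hCB _) (abs_nonneg _) hCA0
  have h2 : |∫ U, A (torusLift M U) ∂(wilsonMeasure (d := 4) (L := M) ρ β)| ≤ CA :=
    abs_integral_le_of_abs_le fun U => hCA _
  have h3 : |∫ U, B (torusLift M U) ∂(wilsonMeasure (d := 4) (L := M) ρ β)| ≤ CB :=
    abs_integral_le_of_abs_le fun U => hCB _
  calc _ ≤ |∫ U, A (torusLift M U) *
        B (Literature.MathematicalPhysics.QuantumLattice.configShift (-Pi.single 0 (t : ℤ))
          (torusLift M U)) ∂(wilsonMeasure (d := 4) (L := M) ρ β)| +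
        |(∫ U, A (torusLift M U) ∂(wilsonMeasure (d := 4) (L := M) ρ β)) *
          ∫ U, B (torusLift M U) ∂(wilsonMeasure (d := 4) (L := M) ρ β)| := abs_sub _ _
    _ ≤ CA * CB + CA * CB := by
        rw [abs_mul]
        exact add_le_add h1 (mul_le_mul h2 h3 (abs_nonneg _) hCA0)
    _ = 2 * CA * CB := by ring

/-- **One-point comparison across two tori.**  If a box `Λ` together with the support `SF` of a
bounded measurable cylinder observable `F` and the collar of `Λ` injects into both tori
`(ℤ/M₁)⁴` and `(ℤ/M₂)⁴`, then the two torus means of `F` differ by at most the oscillation `Δ` of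
the box-kernel mean `η ↦ γ_Λ(F | η)` over exterior conditions (torus DLR equation with far factor
`H = 1` on each torus, then averaging). -/
theorem abs_torusMean_sub_torusMean_le (ρ : G →* Matrix (Fin N) (Fin N) ℂ) (hρ : Continuous ρ)
    (β : ℝ) (Λ : Finset (ZdEdge 4)) {F : LGConfig 4 G → ℝ} (hFm : Measurable F) {CF : ℝ}
    (hFb : ∀ U, |F U| ≤ CF) {SF : Finset (ZdEdge 4)} (hFS : IsCylinder F SF) (M₁ M₂ : ℕ)
    [NeZero M₁] [NeZero M₂]
    (hinj₁ : Set.InjOn (Torus.proj M₁)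
      ((Λ ∪ SF ∪ (plaquettesTouching Λ).biUnion plaquetteEdges).image Prod.fst :
        Set (Site 4)))
    (hinj₂ : Set.InjOn (Torus.proj M₂)
      ((Λ ∪ SF ∪ (plaquettesTouching Λ).biUnion plaquetteEdges).image Prod.fst :
        Set (Site 4)))
    {Δ : ℝ} (hΔ : ∀ η η' : LGConfig 4 G,
      |(∫ U, F U ∂(ymSpecification ρ β Λ η)) - ∫ U, F U ∂(ymSpecification ρ β Λ η')| ≤ Δ) :
    |(∫ V, F (torusLift M₁ V) ∂(wilsonMeasure (d := 4) (L := M₁) ρ β)) -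
      ∫ V, F (torusLift M₂ V) ∂(wilsonMeasure (d := 4) (L := M₂) ρ β)| ≤ Δ := by
  haveI := isProbabilityMeasure_wilsonMeasure (d := 4) (L := M₁) ρ hρ β
  haveI := isProbabilityMeasure_wilsonMeasure (d := 4) (L := M₂) ρ hρ β
  have hγ := isSpecification_ymSpecification_of_t2Space (d := 4) ρ hρ β
  have hgm : Measurable fun η : LGConfig 4 G => ∫ U, F U ∂(ymSpecification ρ β Λ η) :=
    DobrushinShlosman.measurable_windowAvg' hγ Λ hFm
  have hgb : ∀ η : LGConfig 4 G, |∫ U, F U ∂(ymSpecification ρ β Λ η)| ≤ CF := fun η =>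
    abs_integral_ymSpecification_le ρ hρ β Λ hFb η
  have h1 := integral_torusLift_mul_eq_integral_ymSpecification_mul_of_measurable ρ hρ β Λ hFm
    hFb hFS hinj₁ (H := fun _ => (1 : ℝ)) measurable_const (D := 1) (fun _ => by simp)
    (fun _ _ => rfl)
  have h2 := integral_torusLift_mul_eq_integral_ymSpecification_mul_of_measurable ρ hρ β Λ hFm
    hFb hFS hinj₂ (H := fun _ => (1 : ℝ)) measurable_const (D := 1) (fun _ => by simp)
    (fun _ _ => rfl)
  simp only [mul_one] at h1 h2
  rw [h1, h2]
  exact abs_integral_sub_integral_le_of_forall _ _ (hgm.comp (measurable_torusLift M₁))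
    (hgm.comp (measurable_torusLift M₂)) (fun V => hgb _) (fun V => hgb _) fun V W => hΔ _ _

end Torus

end Summit.QuantumFields.YangMills.Cruxes.FiniteSizeInsensitivity.Rung

end
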